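/-
Origin: expansion seat `planner-pub-hodgecm-toy2-g2-0`, handover #4 v2 2026-08-18T05:26:25Z (optional) (`HOME/pub-hodgecm-toy2-g2/lean/Toy2g2/StarAlgDuality.lean`, md5 feca4fa1, 363 lines);
landed by the gen-6 packager in gate run 23 as `HodgeCM/Model/Toy/StarAlgDuality.lean` (verbatim).
-/
-- HANDOVER (planner-pub-hodgecm-toy2-g2-0, unit pub-hodgecm-toy2-g2): WIP module `Toy2g2.StarAlgDuality` (v2); intended final
-- module `HodgeCM.Model.Toy.StarAlgDuality` (kind L5, toy model / consistency witness).  Imports are FINAL run-22 names; nothing to rewrite.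
/-
Copyright: pub-hodgecm cell (HodgeCMPerL). Consistency-witness layer (part (e), referee A G4).

# M28 `Fact_algDuality` in the exterior model — a second, basis-free proof (namespace `HodgeCM.Toy.Star`)

M28 for the exterior model is the toy seat's theorem `HodgeCM.Toy.fact_algDuality` (`HodgeCM/Model/Toy/Duality.lean`,
gate run 22: twisted trace-form star written in the trace basis and its conjugate dual basis).  This file is an
INDEPENDENT cross-check of the same statement by a different construction — the basis-free pairing-dual Hodge star of
`Star{Top,Dual,Obj,Hodge}` (run 22) — and deliberately proves nothing about `toyModel` by name (all `toyModel_*`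
corollaries are the toy seat's, `HodgeCM/Model/Toy/Toy.lean` v2); every declaration below lives in `HodgeCM.Toy.Star`
or `HodgeCM.Toy.Obj`, so no name meets `Duality.lean`.

For the corner product `P = A₀ × A₁ × A₂ × A₃` (`PP K Φ`, `L P = F_K⁴`) we take
`D := ⋆_b : ⋀^{2d-4} L P → ⋀⁴ L P`, the Hodge star (`HodgeCM.Toy.Star.star`) of the twisted trace form
`b(x, y) = Σ_j Tr_{F_K/ℚ}(x_j · ȳ_j)` (`Obj.ConjData.form` for the slotwise complex conjugation `cF K`).

* `lin_eq_mulLeft_of_isDiagAct` (rigidity): a morphism `M : P → P` acting diagonally through `a ∈ K`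
  (`IsDiagAct K Φ a M`) has `M.lin = (left multiplication by the diagonal image cK a of a in L P)`;
* `det_mulLeft_cK`: `det (cK a ·) = N_{K/ℚ}(a)⁴`;
* `starPP_equivariance`: `ā^* ∘ D ∘ a^* = N(a)⁴ · D` (from `Star.star_twisted_equivariance`, the adjoint pair
  being `(cK ā ·, cK a ·)` by `ConjData.form_mulLeft'`);
* `starPP_alg`: `D` maps `alg^{d-2}` into `alg²` (from `ConjData.thetaLin_starQ_mem_FF`);
* `Star.fact_algDuality : (toyModelWith exteriorHodgeData).Fact_algDuality` (the same type as the toy seat's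
  `HodgeCM.Toy.fact_algDuality`; `toyModel` is `toyModelWith exteriorHodgeData` by definition).
-/
import Summits.HodgeConjecture.HodgeCM.Model.Toy.StarHodge
import Summits.HodgeConjecture.HodgeCM.Model.Toy.Weil_2
import Summits.HodgeConjecture.HodgeCM.Model.Toy.ExteriorHodge
import Summits.HodgeConjecture.HodgeCM.Model.Toy.Axioms
import Summits.HodgeConjecture.HodgeCM.Model.Toy.Isogeny

namespace HodgeCM.Toy

open Literature.AlgebraicGeometry.Motives
open Literature.AlgebraicGeometry.ShimuraVarieties (conjRingHomK)
open scoped TensorProduct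
open exteriorPower CMPresentation

noncomputable section

/-! ### Generic lemmas -/

section generic

variable {R : Type*} [CommRing R] {M N : Type*} [AddCommGroup M] [Module R M] [AddCommGroup N] [Module R N]

/-- `map 1` is faithful. -/
lemma eq_of_map_one_eq {f g : M →ₗ[R] N} (h : map 1 f = map 1 g) : f = g := by
  rw [map_one_eq, map_one_eq] at h
  refine LinearMap.ext fun v => ?_
  have := LinearMap.congr_fun h ((oneEquiv R M).symm v)
  simp only [LinearMap.coe_comp, LinearEquiv.coe_coe, Function.comp_apply,
    LinearEquiv.apply_symm_apply] at this
  exact (oneEquiv R N).symm.injective this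

/-- `map 4` of the zero map is zero. -/
lemma map_four_zero : map 4 (0 : M →ₗ[R] N) = 0 := by
  apply linearMap_ext
  refine AlternatingMap.ext fun v => ?_
  rw [LinearMap.compAlternatingMap_apply, LinearMap.compAlternatingMap_apply, map_apply_ιMulti,
    LinearMap.zero_apply]
  exact AlternatingMap.map_coord_zero (ιMulti R 4) (m := ⇑(0 : M →ₗ[R] N) ∘ v) (0 : Fin 4) rfl

/-- `det (c ·) = N(c)` (Mathlib's definition of the norm, restated for `LinearMap.mulLeft`). -/
lemma det_mulLeft_eq_norm {A : Type*} [Ring A] [Algebra ℚ A] (c : A) :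
    LinearMap.det (LinearMap.mulLeft ℚ c) = Algebra.norm ℚ c := by
  rw [Algebra.norm_apply]
  exact congrArg LinearMap.det (LinearMap.ext fun _ => rfl)

/-- the norm of a tuple in a product of copies of a field is the product of the norms -/
lemma norm_pi {ι : Type*} [Fintype ι] {F : Type*} [Field F] [Algebra ℚ F] [FiniteDimensional ℚ F]
    (y : ι → F) : Algebra.norm ℚ y = ∏ i, Algebra.norm ℚ (y i) := by
  have h : Algebra.lmul ℚ (ι → F) y
      = LinearMap.pi (fun i => (LinearMap.mulLeft ℚ (y i)).comp (LinearMap.proj i)) :=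
    LinearMap.ext fun _ => funext fun _ => rfl
  rw [Algebra.norm_apply, h, LinearMap.det_pi]
  exact Finset.prod_congr rfl fun i _ => det_mulLeft_eq_norm (y i)

end generic

namespace Obj

/-- left multiplication by `c` on the `j`-th coordinate line is left multiplication by `c j` -/
lemma mulLeft_comp_single (X : Obj) (c : X.L) (j : X.s.toType) :
    LinearMap.mulLeft ℚ c ∘ₗ LinearMap.single ℚ (fun j => ((X.atom j).F : Type)) j
      = LinearMap.single ℚ (fun j => ((X.atom j).F : Type)) j ∘ₗ LinearMap.mulLeft ℚ (c j) := by
  refine LinearMap.ext fun y => ?_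
  simp only [LinearMap.coe_comp, Function.comp_apply, LinearMap.coe_single, LinearMap.mulLeft_apply]
  exact (Pi.single_mul_right (f := c) y).symm

/-- constant-slot version of `mulLeft_comp_single` -/
lemma const_mulLeft_comp_single {F : Type*} [Ring F] [Algebra ℚ F] (z : F) :
    LinearMap.mulLeft ℚ (Function.const Unit z) ∘ₗ LinearMap.single ℚ (fun _ : Unit => F) ()
      = LinearMap.single ℚ (fun _ : Unit => F) () ∘ₗ LinearMap.mulLeft ℚ z := by
  refine LinearMap.ext fun y => ?_
  simp only [LinearMap.coe_comp, Function.comp_apply, LinearMap.coe_single, LinearMap.mulLeft_apply]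
  exact (Pi.single_mul_right (f := Function.const Unit z) y).symm

/-- **One slot of the rigidity argument.** If `f` commutes with the inclusion `ι` of the `j`-th
coordinate line up to the scalar `c j`, then `f` agrees with `c ·` on that line. -/
lemma comp_single_eq_of_slot (X : Obj) (j : X.s.toType) (f : X.L →ₗ[ℚ] X.L) (c : X.L)
    (ι : (Unit → (X.atom j).F) →ₗ[ℚ] X.L)
    (hι : ι ∘ₗ LinearMap.single ℚ (fun _ : Unit => ((X.atom j).F : Type)) ()
      = LinearMap.single ℚ (fun j => ((X.atom j).F : Type)) j)
    (hf : f ∘ₗ ι = ι ∘ₗ LinearMap.mulLeft ℚ (Function.const Unit (c j))) :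
    f ∘ₗ LinearMap.single ℚ (fun j => ((X.atom j).F : Type)) j
      = LinearMap.mulLeft ℚ c ∘ₗ LinearMap.single ℚ (fun j => ((X.atom j).F : Type)) j :=
  calc f ∘ₗ LinearMap.single ℚ (fun j => ((X.atom j).F : Type)) j
      = f ∘ₗ (ι ∘ₗ LinearMap.single ℚ (fun _ : Unit => ((X.atom j).F : Type)) ()) := by rw [hι]
    _ = (ι ∘ₗ LinearMap.mulLeft ℚ (Function.const Unit (c j)))
          ∘ₗ LinearMap.single ℚ (fun _ : Unit => ((X.atom j).F : Type)) () := by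
        rw [← LinearMap.comp_assoc, hf]
    _ = ι ∘ₗ (LinearMap.single ℚ (fun _ : Unit => ((X.atom j).F : Type)) () ∘ₗ LinearMap.mulLeft ℚ (c j)) := by
        rw [LinearMap.comp_assoc, const_mulLeft_comp_single]
    _ = LinearMap.single ℚ (fun j => ((X.atom j).F : Type)) j ∘ₗ LinearMap.mulLeft ℚ (c j) := by
        rw [← LinearMap.comp_assoc, hι]
    _ = LinearMap.mulLeft ℚ c ∘ₗ LinearMap.single ℚ (fun j => ((X.atom j).F : Type)) j :=
        (X.mulLeft_comp_single c j).symm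

end Obj

/-! ### The corner product `P = PP K Φ`: diagonal scalars, conjugation, the four slots -/

namespace Star

section PP

variable (K : CMField) (Φ : Fin 4 → CMType K)

/-- `N(ā) = N(a)` -/
lemma norm_conjRingHomK (a : K) : Algebra.norm ℚ (conjRingHomK K a) = Algebra.norm ℚ a := by
  let e : K ≃ₐ[ℚ] K :=
    AlgEquiv.ofRingEquiv (f := (NumberField.IsCMField.complexConj K).toRingEquiv) (fun x => by simp)
  exact (Algebra.norm_eq_of_algEquiv e a : _)

/-- the embedding `K → F_j = F_K` of each slot -/
def cKc : ∀ j : (PP K Φ).s.toType, K →+* ((PP K Φ).atom j).F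
  | Sum.inl (Sum.inl (Sum.inl _)) => (eK K : K →+* FK K)
  | Sum.inl (Sum.inl (Sum.inr _)) => (eK K : K →+* FK K)
  | Sum.inl (Sum.inr _) => (eK K : K →+* FK K)
  | Sum.inr _ => (eK K : K →+* FK K)

/-- the diagonal image `cK a = (a, a, a, a)` of `a ∈ K` in `L P = F_K⁴` -/
def cK : K →+* (PP K Φ).L := RingHom.pi (cKc K Φ)

/-- slotwise complex conjugation on `L P` … -/
def cPc : ∀ j : (PP K Φ).s.toType, ((PP K Φ).atom j).F →+* ((PP K Φ).atom j).F
  | Sum.inl (Sum.inl (Sum.inl _)) => cF K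
  | Sum.inl (Sum.inl (Sum.inr _)) => cF K
  | Sum.inl (Sum.inr _) => cF K
  | Sum.inr _ => cF K

/-- (Ported verbatim from the HodgeCMPerL package; no docstring in the source.) -/
lemma emb_cPc : ∀ (j : (PP K Φ).s.toType) (τ : ((PP K Φ).atom j).F →+* ℂ) (x : ((PP K Φ).atom j).F),
    τ (cPc K Φ j x) = starRingEnd ℂ (τ x)
  | Sum.inl (Sum.inl (Sum.inl _)), τ, x => emb_cF K τ x
  | Sum.inl (Sum.inl (Sum.inr _)), τ, x => emb_cF K τ x
  | Sum.inl (Sum.inr _), τ, x => emb_cF K τ x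
  | Sum.inr _, τ, x => emb_cF K τ x

/-- … as conjugation data -/
def CP : (PP K Φ).ConjData := ⟨cPc K Φ, emb_cPc K Φ⟩

/-- (Ported verbatim from the HodgeCMPerL package; no docstring in the source.) -/
lemma cL_cK (a : K) : (CP K Φ).cL (cK K Φ a) = cK K Φ (conjRingHomK K a) := by
  funext j
  rcases j with ((⟨⟩ | ⟨⟩) | ⟨⟩) | ⟨⟩ <;> exact cF_eK K a

/-- `cK b ·` is invertible for `b ≠ 0` -/
lemma mulLeft_cK_bijective {b : K} (hb : b ≠ 0) :
    Function.Bijective (LinearMap.mulLeft ℚ (cK K Φ b)) := by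
  have h1 : ∀ v : (PP K Φ).L, cK K Φ b⁻¹ * (cK K Φ b * v) = v := fun v => by
    rw [← mul_assoc, ← map_mul, inv_mul_cancel₀ hb, map_one, one_mul]
  have h2 : ∀ v : (PP K Φ).L, cK K Φ b * (cK K Φ b⁻¹ * v) = v := fun v => by
    rw [← mul_assoc, ← map_mul, mul_inv_cancel₀ hb, map_one, one_mul]
  exact Function.bijective_iff_has_inverse.mpr ⟨LinearMap.mulLeft ℚ (cK K Φ b⁻¹), h1, h2⟩

/-- slotwise identification of `L P` with the constant family `F_K⁴` -/
def slotEquiv : ∀ j : (PP K Φ).s.toType, ((PP K Φ).atom j).F ≃ₐ[ℚ] FK K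
  | Sum.inl (Sum.inl (Sum.inl _)) => AlgEquiv.refl
  | Sum.inl (Sum.inl (Sum.inr _)) => AlgEquiv.refl
  | Sum.inl (Sum.inr _) => AlgEquiv.refl
  | Sum.inr _ => AlgEquiv.refl

/-- `L P ≃ₐ F_K⁴` -/
def LEquiv : (PP K Φ).L ≃ₐ[ℚ] ((PP K Φ).s.toType → FK K) := AlgEquiv.piCongrRight (slotEquiv K Φ)

/-- (Ported verbatim from the HodgeCMPerL package; no docstring in the source.) -/
lemma LEquiv_cK (a : K) (j : (PP K Φ).s.toType) : LEquiv K Φ (cK K Φ a) j = eK K a := by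
  rcases j with ((⟨⟩ | ⟨⟩) | ⟨⟩) | ⟨⟩ <;> rfl

/-- (Ported verbatim from the HodgeCMPerL package; no docstring in the source.) -/
lemma card_slots : Fintype.card (PP K Φ).s.toType = 4 := rfl

/-- `dim_ℚ L P = 4 [K:ℚ]` -/
lemma finrank_L_PP : Module.finrank ℚ (PP K Φ).L = 4 * Module.finrank ℚ K := by
  rw [(LEquiv K Φ).toLinearEquiv.finrank_eq, Module.finrank_pi_fintype, Finset.sum_const, Finset.card_univ,
    card_slots, smul_eq_mul, finrank_FK]

/-- `det (cK a ·) = N(a)⁴` -/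
lemma det_mulLeft_cK (a : K) : LinearMap.det (LinearMap.mulLeft ℚ (cK K Φ a)) = Algebra.norm ℚ a ^ 4 := by
  rw [det_mulLeft_eq_norm, ← Algebra.norm_eq_of_algEquiv (LEquiv K Φ), norm_pi]
  have h : (fun j => Algebra.norm ℚ (LEquiv K Φ (cK K Φ a) j)) = fun _ => Algebra.norm ℚ a := by
    funext j
    rw [LEquiv_cK, Algebra.norm_eq_of_algEquiv]
  rw [h, Finset.prod_const, Finset.card_univ, card_slots]

variable (D : HodgeData)

/-! ### Rigidity of diagonal actions -/

/-- the `i`-th projection `P → A_i` (its `lin` is the inclusion `L A_i → L P`), typed over `PP K Φ` -/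
abbrev prl (i : Fin 4) : Obj.Hom (PP K Φ) (cmObj K (Φ i)) := (toyModelWith D).pr4 K Φ i

/-- (Ported verbatim from the HodgeCMPerL package; no docstring in the source.) -/
lemma pr4_comp_single_0 :
    (prl K Φ D 0).lin ∘ₗ LinearMap.single ℚ (fun _ : Unit => (FK K : Type)) ()
      = LinearMap.single ℚ (fun j => (((PP K Φ).atom j).F : Type)) (Sum.inl (Sum.inl (Sum.inl ()))) := by
  show ((Obj.fst _ _).comp ((Obj.fst _ _).comp (Obj.fst _ _))).lin ∘ₗ _ = _
  simp only [Obj.Hom.comp, Obj.fst, LinearMap.comp_assoc]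
  rw [Obj.inlL_comp_single (X := (cmObj K (Φ 0))) (Y := (cmObj K (Φ 1))) (),
    Obj.inlL_comp_single (X := ((cmObj K (Φ 0)).prod (cmObj K (Φ 1)))) (Y := (cmObj K (Φ 2))),
    Obj.inlL_comp_single (X := (((cmObj K (Φ 0)).prod (cmObj K (Φ 1))).prod (cmObj K (Φ 2)))) (Y := (cmObj K (Φ 3)))]
  rfl

/-- (Ported verbatim from the HodgeCMPerL package; no docstring in the source.) -/
lemma pr4_comp_single_1 :
    (prl K Φ D 1).lin ∘ₗ LinearMap.single ℚ (fun _ : Unit => (FK K : Type)) ()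
      = LinearMap.single ℚ (fun j => (((PP K Φ).atom j).F : Type)) (Sum.inl (Sum.inl (Sum.inr ()))) := by
  show ((Obj.fst _ _).comp ((Obj.fst _ _).comp (Obj.snd _ _))).lin ∘ₗ _ = _
  simp only [Obj.Hom.comp, Obj.fst, Obj.snd, LinearMap.comp_assoc]
  rw [Obj.inrL_comp_single (X := (cmObj K (Φ 0))) (Y := (cmObj K (Φ 1))) (),
    Obj.inlL_comp_single (X := ((cmObj K (Φ 0)).prod (cmObj K (Φ 1)))) (Y := (cmObj K (Φ 2))),
    Obj.inlL_comp_single (X := (((cmObj K (Φ 0)).prod (cmObj K (Φ 1))).prod (cmObj K (Φ 2)))) (Y := (cmObj K (Φ 3)))]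
  rfl

/-- (Ported verbatim from the HodgeCMPerL package; no docstring in the source.) -/
lemma pr4_comp_single_2 :
    (prl K Φ D 2).lin ∘ₗ LinearMap.single ℚ (fun _ : Unit => (FK K : Type)) ()
      = LinearMap.single ℚ (fun j => (((PP K Φ).atom j).F : Type)) (Sum.inl (Sum.inr ())) := by
  show ((Obj.fst _ _).comp (Obj.snd _ _)).lin ∘ₗ _ = _
  simp only [Obj.Hom.comp, Obj.fst, Obj.snd, LinearMap.comp_assoc]
  rw [Obj.inrL_comp_single (X := ((cmObj K (Φ 0)).prod (cmObj K (Φ 1)))) (Y := (cmObj K (Φ 2))) (),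
    Obj.inlL_comp_single (X := (((cmObj K (Φ 0)).prod (cmObj K (Φ 1))).prod (cmObj K (Φ 2)))) (Y := (cmObj K (Φ 3)))]
  rfl

/-- (Ported verbatim from the HodgeCMPerL package; no docstring in the source.) -/
lemma pr4_comp_single_3 :
    (prl K Φ D 3).lin ∘ₗ LinearMap.single ℚ (fun _ : Unit => (FK K : Type)) ()
      = LinearMap.single ℚ (fun j => (((PP K Φ).atom j).F : Type)) (Sum.inr ()) := by
  show (Obj.snd _ _).lin ∘ₗ _ = _
  simp only [Obj.snd]
  rw [Obj.inrL_comp_single (X := (((cmObj K (Φ 0)).prod (cmObj K (Φ 1))).prod (cmObj K (Φ 2)))) (Y := (cmObj K (Φ 3))) ()]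
  rfl

variable {K Φ D} in
/-- **Rigidity.** A diagonal action through `a` is left multiplication by `cK a` on `L P`. -/
theorem lin_eq_mulLeft_of_isDiagAct {a : K} {M : Obj.Hom (PP K Φ) (PP K Φ)}
    (h : (toyModelWith D).IsDiagAct K Φ a M) : M.lin = LinearMap.mulLeft ℚ (cK K Φ a) := by
  obtain ⟨e, he1, he2⟩ := h
  have hmulK : ∀ i, mulK K (Φ i) a = LinearMap.mulLeft ℚ (Function.const Unit (eK K a)) := fun i => rfl
  have h2 : ∀ i, M.lin ∘ₗ (prl K Φ D i).lin
      = (prl K Φ D i).lin ∘ₗ LinearMap.mulLeft ℚ (Function.const Unit (eK K a)) := by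
    intro i
    have h1 : (e i).lin = mulK K (Φ i) a := by
      apply eq_of_map_one_eq
      rw [← cmAct_ι_eq (D := D)]
      exact he1 i
    apply eq_of_map_one_eq
    rw [map_comp, map_comp, ← hmulK, ← h1]
    exact he2 i 1
  apply LinearMap.pi_ext'
  intro j
  rcases j with ((⟨⟩ | ⟨⟩) | ⟨⟩) | ⟨⟩
  · exact (PP K Φ).comp_single_eq_of_slot _ M.lin (cK K Φ a) (prl K Φ D 0).lin (pr4_comp_single_0 K Φ D) (h2 0)
  · exact (PP K Φ).comp_single_eq_of_slot _ M.lin (cK K Φ a) (prl K Φ D 1).lin (pr4_comp_single_1 K Φ D) (h2 1)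
  · exact (PP K Φ).comp_single_eq_of_slot _ M.lin (cK K Φ a) (prl K Φ D 2).lin (pr4_comp_single_2 K Φ D) (h2 2)
  · exact (PP K Φ).comp_single_eq_of_slot _ M.lin (cK K Φ a) (prl K Φ D 3).lin (pr4_comp_single_3 K Φ D) (h2 3)

/-! ### Dimensions -/

/-- (Ported verbatim from the HodgeCMPerL package; no docstring in the source.) -/
lemma extra_PP : (PP K Φ).extra = 0 := rfl

/-- `dim P = 2[K:ℚ]` -/
lemma dim_PP : (toyModelWith D).dim (PP K Φ) = 2 * Module.finrank ℚ K := by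
  rw [dim_eq, finrank_L_PP, extra_PP]
  omega

/-- `dim_ℚ L P = (2 dim P - 4) + 4` (the degree bookkeeping of the star `⋀^{2d-4} → ⋀⁴`) -/
lemma finrank_eq_PP : Module.finrank ℚ (PP K Φ).L = 2 * ((toyModelWith D).dim (PP K Φ) - 2) + 4 := by
  rw [dim_PP, finrank_L_PP]
  have := Module.finrank_pos (R := ℚ) (M := K)
  omega

/-- (Ported verbatim from the HodgeCMPerL package; no docstring in the source.) -/
lemma card_Idx_PP : 4 + 2 * ((toyModelWith D).dim (PP K Φ) - 2) = Fintype.card (PP K Φ).Idx := by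
  rw [Obj.card_Idx, finrank_eq_PP K Φ D]
  ring

/-! ### The duality map `D = ⋆_b` and its two properties -/

/-- **The M28 map** `D : H^{2d-4}(P) → H⁴(P)`: the Hodge star of the twisted trace form. -/
abbrev starPP : ⋀[ℚ]^(2 * ((toyModelWith D).dim (PP K Φ) - 2)) (PP K Φ).L →ₗ[ℚ] ⋀[ℚ]^4 (PP K Φ).L :=
  (CP K Φ).starQ (finrank_eq_PP K Φ D)

/-- (Ported verbatim from the HodgeCMPerL package; no docstring in the source.) -/
theorem starPP_bijective : Function.Bijective (starPP K Φ D) :=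
  Star.star_bijective (finrank_eq_PP K Φ D) (CP K Φ).form (CP K Φ).form_nondegenerate

/-- **Equivariance** `ā^* ∘ D ∘ a^* = N(a)⁴ · D` for diagonal actions. -/
theorem starPP_equivariance (a : K) (Ma Mb : Obj.Hom (PP K Φ) (PP K Φ))
    (ha : (toyModelWith D).IsDiagAct K Φ a Ma) (hb : (toyModelWith D).IsDiagAct K Φ (conjRingHomK K a) Mb) :
    map 4 Mb.lin ∘ₗ starPP K Φ D ∘ₗ map (2 * ((toyModelWith D).dim (PP K Φ) - 2)) Ma.lin
      = (Algebra.norm ℚ a ^ 4) • starPP K Φ D := by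
  have hMa := lin_eq_mulLeft_of_isDiagAct ha
  have hMb := lin_eq_mulLeft_of_isDiagAct hb
  by_cases ha0 : a = 0
  · subst ha0
    rw [map_zero, map_zero, LinearMap.mulLeft_zero_eq_zero] at hMb
    rw [hMb, map_four_zero, LinearMap.zero_comp, Algebra.norm_zero, zero_pow four_ne_zero, zero_smul]
  · have hdet : LinearMap.det Mb.lin = Algebra.norm ℚ a ^ 4 := by
      rw [hMb, det_mulLeft_cK, norm_conjRingHomK]
    rw [← hdet]
    refine Star.star_twisted_equivariance (finrank_eq_PP K Φ D) (CP K Φ).form ?_ ?_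
    · intro u w
      rw [hMa, hMb, ← cL_cK]
      exact (CP K Φ).form_mulLeft' (cK K Φ a) u w
    · rw [hMb]
      exact mulLeft_cK_bijective K Φ ((map_ne_zero _).mpr ha0)

end PP

/-! ### Hodge classes: `D(alg^{d-2}) ⊆ alg²` for the exterior Hodge datum -/

section Hodge

variable (K : CMField) (Φ : Fin 4 → CMType K)

/-- the exterior CM-model with the exterior Hodge datum (`= toyModel` by definition, `HodgeCM/Model/Toy/Toy.lean`) -/
abbrev exteriorModel : Universe := toyModelWith exteriorHodgeData

/-- (Ported verbatim from the HodgeCMPerL package; no docstring in the source.) -/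
theorem starPP_alg :
    (exteriorModel.alg (PP K Φ) (exteriorModel.dim (PP K Φ) - 2)).map (starPP K Φ exteriorHodgeData)
      ≤ exteriorModel.alg (PP K Φ) 2 := by
  rw [Submodule.map_le_iff_le_comap]
  intro v hv
  have hv' : (PP K Φ).Θ _ ((1 : ℂ) ⊗ₜ[ℚ] v)
      ∈ (PP K Φ).FF (2 * (exteriorModel.dim (PP K Φ) - 2)) ((exteriorModel.dim (PP K Φ) - 2 : ℕ) : ℤ) := hv
  rw [Obj.theta_one_tmul] at hv'
  show (PP K Φ).Θ 4 ((1 : ℂ) ⊗ₜ[ℚ] (starPP K Φ exteriorHodgeData v)) ∈ (PP K Φ).FF 4 ((2 : ℕ) : ℤ)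
  rw [Obj.theta_one_tmul]
  refine (CP K Φ).thetaLin_starQ_mem_FF (finrank_eq_PP K Φ exteriorHodgeData)
    (card_Idx_PP K Φ exteriorHodgeData) ?_ hv'
  push_cast
  omega

/-- **M28 for the exterior model, second proof** (same statement as the toy seat's `HodgeCM.Toy.fact_algDuality`). -/
theorem fact_algDuality : (toyModelWith exteriorHodgeData).Fact_algDuality := by
  intro K Φ
  refine ⟨starPP K Φ exteriorHodgeData, starPP_bijective K Φ exteriorHodgeData, starPP_alg K Φ, ?_⟩
  intro a Ma Mb ha hb
  exact starPP_equivariance K Φ exteriorHodgeData a Ma Mb ha hb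

end Hodge

end Star


end

end HodgeCM.Toy
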